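import Summits.PneNP.PneNP.Theorems.NegLimitedGapPMExp
import Summits.PneNP.PneNP.Theorems.NegLimitedHeteroDomination

/-!
# Route NegLimited — the registered stub `stub_gapPMExp` of line `r7-crosscut` (rung F-N1/p3, item stmt-PneNP-19861)

One-liner over `gapPMExp_of` (`NegLimitedGapPMExp.lean`): the registered signature
`HeteroDomination → BiasedMatchingSunflower → CrossDeficient → DeficientMass → GapPerfectMatchingExp`
(skeleton HOME/pnp-ideate-p3/Skeleton-R7-crosscut-v3.lean, sha be8e37ccfb7cddd0). `HeteroDomination`
(declared in `NegLimitedHeteroDomination.lean`) is part of the signature but is not used: the biased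
Claim 1 of R7-B went through the flip coupling of `NegLimitedBiasedMeasureFlip.lean`; the constant of the
biased Matching Sunflower Lemma is obtained from the `BiasedMatchingSunflower` hypothesis itself.
-/

set_option linter.dupNamespace false -- `Summit.PneNP.PneNP.…`: summit = sub-problem name (D-0017 single-conjunct layout)

namespace Summit.PneNP.PneNP.Theorems.NegLimitedGapPM

/-- **Registered stub `stub_gapPMExp` of line `r7-crosscut`** (item stmt-PneNP-19861): the CKR closure
engine run once on the `1/8`-biased cross-cut measure with biased matching sunflowers, by name. -/
theorem stub_gapPMExp :
    HeteroDomination → BiasedMatchingSunflower → CrossDeficient → DeficientMass →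
      GapPerfectMatchingExp := by
  intro _ hB hCD hDM
  obtain ⟨c₀, hc₀, hSF⟩ := hB
  exact gapPMExp_of hSF hc₀ hCD hDM

end Summit.PneNP.PneNP.Theorems.NegLimitedGapPM
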